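import Literature.Analysis.Fourier.ChirpLevelSet
import Literature.Analysis.Fourier.ChirpCutoffs
import HarnessLib

/-!
# Second-order Euler–Maclaurin summation along the level set of a chirp

For a chirp phase `φ` (`ChirpPhase φ H L Cφ`, `φ(H) = 0`) with level points `γ_n ≥ H`,
`φ(γ_n) = n`, and `F ∈ C²` (`F' = F₁`, `F₁' = F₂`), summing the trapezoidal cell identity
`cell_identity` (`ChirpLevelSet.lean`) over the cells `[γ_n, γ_{n+1}]` gives the second-order
Euler–Maclaurin formula along the level set
`Σ_{n<N} F(γ_n) = ½F(H) − ½F(γ_N) + ∫_H^{γ_N} (F φ' − W · P(φ))`,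
`W = F₂/φ' − F₁ φ''/φ'²` (`emW`), `P(y) = ({y}² − {y})/2` (`perB2`, the periodic Bernoulli function
`(B₂({y}) − 1/6)/2`), and its limit `N → ∞` (`ChirpPhase.tendsto_sum_range_level`). We also record
the Fourier series `P(y) + 1/12 = Σ_{k≥1} cos(2πky)/(2π²k²)` (from Mathlib's
`hasSum_one_div_nat_pow_mul_cos`) and the boundary identity
`∫_{τ>H} ρ_H W = −∫_{τ>H} ρ_H' F₁/φ'` (`W = (F₁/φ')'`). Source: Olver, *Asymptotics and Special
Functions* (1974), Ch. 8 §1; everything is proved, the only definitions are the two integrands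
`perB2`, `emW` (abbreviations, not named facts).
-/

noncomputable section

open Set Filter MeasureTheory
open scoped Topology ContDiff Real

namespace Literature.Analysis.Fourier

open _root_.Complex (I exp)

/-! ## The periodic Bernoulli function `P(y) = ({y}² − {y})/2` -/

/-- `P(y) = ((fract y)² − fract y)/2 = (B₂({y}) − 1/6)/2`, the kernel of the second-order
Euler–Maclaurin formula. [folklore] -/
def perB2 (y : ℝ) : ℝ := (Int.fract y ^ 2 - Int.fract y) / 2

/-- On a cell `[m, m+1]` (`m ∈ ℤ`), `P(y) = ((y − m)² − (y − m))/2` (both sides vanish at the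
right end point). [folklore] -/
theorem perB2_eq_of_mem_Icc {y : ℝ} {m : ℤ} (h : y ∈ Icc (m : ℝ) (m + 1)) :
    perB2 y = ((y - m) ^ 2 - (y - m)) / 2 := by
  rcases h.2.eq_or_lt with h1 | h1
  · have : Int.fract y = 0 := by
      rw [h1, show (m : ℝ) + 1 = ((m + 1 : ℤ) : ℝ) by push_cast; ring, Int.fract_intCast]
    rw [perB2, this, h1]
    ring
  · have : Int.fract y = y - m := by
      rw [Int.fract_eq_iff]
      exact ⟨by linarith [h.1], by linarith, m, by ring⟩
    rw [perB2, this]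

/-- `P` vanishes at the integers. [folklore] -/
theorem perB2_intCast (m : ℤ) : perB2 m = 0 := by simp [perB2]

/-- `P(0) = 0`. [folklore] -/
theorem perB2_zero : perB2 0 = 0 := by simp [perB2]

/-- `|P| ≤ 1/8`. [folklore] -/
theorem abs_perB2_le (y : ℝ) : |perB2 y| ≤ 1 / 8 := by
  have h0 := Int.fract_nonneg y
  have h1 := Int.fract_lt_one y
  rw [perB2, abs_le]
  constructor <;> nlinarith [sq_nonneg (Int.fract y - 1 / 2)]

/-- `P` is continuous (the polynomial `(u² − u)/2` takes the same value at `0` and `1`).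
[folklore] -/
theorem continuous_perB2 : Continuous perB2 := by
  have : perB2 = (fun u : ℝ => (u ^ 2 - u) / 2) ∘ Int.fract := rfl
  rw [this]
  exact ContinuousOn.comp_fract'' (by fun_prop) (by norm_num)

/-- `B₂(x) = x² − x + 1/6`. [folklore] -/
theorem eval_map_bernoulli_two (x : ℝ) :
    (Polynomial.map (algebraMap ℚ ℝ) (Polynomial.bernoulli 2)).eval x = x ^ 2 - x + 1 / 6 := by
  have h : Polynomial.bernoulli 2 =
      Polynomial.X ^ 2 - Polynomial.C (1 : ℚ) * Polynomial.X + Polynomial.C (1 / 6 : ℚ) := by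
    simp_rw [Polynomial.bernoulli, Finset.sum_range_succ, Finset.sum_range_zero]
    rw [bernoulli_one, bernoulli_zero, bernoulli_eq_bernoulli'_of_ne_one (by decide : 2 ≠ 1),
      bernoulli'_two]
    simp only [zero_add]
    norm_num [Nat.choose, ← Polynomial.C_mul_X_pow_eq_monomial]
    ring
  rw [h]
  simp

/-- `Σ_{n≥1} cos(2πnx)/n² = π²(x² − x + 1/6)` for `x ∈ [0, 1]` (Mathlib's
`hasSum_one_div_nat_pow_mul_cos`, `k = 1`). [folklore] -/
theorem hasSum_cos_div_sq {x : ℝ} (hx : x ∈ Icc (0 : ℝ) 1) :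
    HasSum (fun n : ℕ => 1 / (n : ℝ) ^ 2 * Real.cos (2 * π * n * x))
      (π ^ 2 * (x ^ 2 - x + 1 / 6)) := by
  have h := hasSum_one_div_nat_pow_mul_cos one_ne_zero hx
  have e1 : (fun n : ℕ => 1 / (n : ℝ) ^ (2 * 1) * Real.cos (2 * π * n * x)) =
      fun n : ℕ => 1 / (n : ℝ) ^ 2 * Real.cos (2 * π * n * x) := by
    funext n; norm_num
  have e2 : (-1 : ℝ) ^ (1 + 1) * (2 * π) ^ (2 * 1) / 2 / (2 * 1).factorial *
      (Polynomial.map (algebraMap ℚ ℝ) (Polynomial.bernoulli (2 * 1))).eval x =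
      π ^ 2 * (x ^ 2 - x + 1 / 6) := by
    rw [show 2 * 1 = 2 from rfl, eval_map_bernoulli_two]
    simp only [Nat.factorial]
    push_cast
    ring
  rw [e1, e2] at h
  exact h

/-- **Fourier series of the periodic Bernoulli function**:
`P(y) + 1/12 = Σ_{n≥1} cos(2πny)/(2π²n²)` for every real `y` (the `n = 0` term is `0`).
[folklore] -/
theorem hasSum_perB2 (y : ℝ) :
    HasSum (fun n : ℕ => Real.cos (2 * π * n * y) / (2 * π ^ 2 * n ^ 2)) (perB2 y + 1 / 12) := by
  have hx : Int.fract y ∈ Icc (0 : ℝ) 1 := ⟨Int.fract_nonneg y, (Int.fract_lt_one y).le⟩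
  have h := (hasSum_cos_div_sq hx).div_const (π ^ 2 * 2)
  have hπ : (π : ℝ) ≠ 0 := Real.pi_ne_zero
  have e1 : (fun n : ℕ => 1 / (n : ℝ) ^ 2 * Real.cos (2 * π * n * Int.fract y) / (π ^ 2 * 2)) =
      fun n : ℕ => Real.cos (2 * π * n * y) / (2 * π ^ 2 * n ^ 2) := by
    funext n
    have hc : Real.cos (2 * π * n * Int.fract y) = Real.cos (2 * π * n * y) := by
      rw [← Int.self_sub_floor, mul_sub,
        show 2 * π * n * (⌊y⌋ : ℝ) = ((n * ⌊y⌋ : ℤ) : ℝ) * (2 * π) by push_cast; ring,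
        Real.cos_sub_int_mul_two_pi]
    rw [hc]
    rcases Nat.eq_zero_or_pos n with rfl | hn
    · simp
    · field_simp
  have e2 : π ^ 2 * (Int.fract y ^ 2 - Int.fract y + 1 / 6) / (π ^ 2 * 2) = perB2 y + 1 / 12 := by
    unfold perB2
    field_simp
    ring
  rw [e1, e2] at h
  exact h

/-- The same series started at `n = 1`. [folklore] -/
theorem hasSum_perB2_succ (y : ℝ) :
    HasSum (fun n : ℕ => Real.cos (2 * π * (n + 1) * y) / (2 * π ^ 2 * (n + 1) ^ 2))
      (perB2 y + 1 / 12) := by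
  have h := (hasSum_nat_add_iff' (f := fun n : ℕ => Real.cos (2 * π * n * y) / (2 * π ^ 2 * n ^ 2))
    1).mpr (hasSum_perB2 y)
  have e1 : (fun n : ℕ => Real.cos (2 * π * ((n + 1 : ℕ) : ℝ) * y) /
      (2 * π ^ 2 * ((n + 1 : ℕ) : ℝ) ^ 2)) =
      fun n : ℕ => Real.cos (2 * π * (n + 1) * y) / (2 * π ^ 2 * (n + 1) ^ 2) := by
    funext n; push_cast; ring_nf
  have e2 : perB2 y + 1 / 12 - ∑ i ∈ Finset.range 1, Real.cos (2 * π * (i : ℝ) * y) /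
      (2 * π ^ 2 * (i : ℝ) ^ 2) = perB2 y + 1 / 12 := by simp
  rw [e1, e2] at h
  exact h

/-! ## The Euler–Maclaurin integrand -/

/-- The remainder weight `W = F₂/φ' − F₁ φ''/φ'²` (`= (F₁/φ')'`) of the second-order
Euler–Maclaurin formula along the level set of `φ`. [folklore] -/
def emW (φ : ℝ → ℝ) (F₁ F₂ : ℝ → ℂ) (t : ℝ) : ℂ :=
  F₂ t * ((deriv φ t)⁻¹ : ℝ) -
    F₁ t * ((deriv (deriv φ) t * (deriv φ t)⁻¹ * (deriv φ t)⁻¹ : ℝ) : ℂ)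

section EM

variable {φ : ℝ → ℝ} {H L : ℝ} {Cφ : ℕ → ℝ} (hφ : ChirpPhase φ H L Cφ)
  {F F₁ F₂ : ℝ → ℂ} (hF : ∀ t, HasDerivAt F (F₁ t) t) (hF₁ : ∀ t, HasDerivAt F₁ (F₂ t) t)
  (hF₂c : Continuous F₂)

include hφ hF₁ hF₂c in
/-- `W` is continuous on `[H, ∞)` (where `φ' ≥ L > 0`). [folklore] -/
theorem ChirpPhase.continuousOn_emW : ContinuousOn (emW φ F₁ F₂) (Ici H) := by
  have hF₁c : Continuous F₁ := continuous_iff_continuousAt.2 fun t => (hF₁ t).continuousAt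
  have hne : ∀ t ∈ Ici H, deriv φ t ≠ 0 := fun t ht => (hφ.pos.trans_le (hφ.deriv_ge t ht)).ne'
  have h1 : ContinuousOn (fun t => (deriv φ t)⁻¹) (Ici H) :=
    hφ.contDiff_deriv.continuous.continuousOn.inv₀ hne
  have h2 : Continuous (deriv (deriv φ)) := (contDiff_infty_iff_deriv.1 hφ.contDiff_deriv).2.continuous
  unfold emW
  refine (hF₂c.continuousOn.mul (Complex.continuous_ofReal.comp_continuousOn h1)).sub
    (hF₁c.continuousOn.mul (Complex.continuous_ofReal.comp_continuousOn ?_))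
  exact (h2.continuousOn.mul h1).mul h1

include hφ hF hF₁ hF₂c in
/-- The Euler–Maclaurin integrand `F φ' − W P(φ)` is continuous on `[H, ∞)`. [folklore] -/
theorem ChirpPhase.continuousOn_emIntegrand :
    ContinuousOn (fun t => F t * ((deriv φ t : ℝ) : ℂ) -
      emW φ F₁ F₂ t * ((perB2 (φ t) : ℝ) : ℂ)) (Ici H) := by
  have hFc : Continuous F := continuous_iff_continuousAt.2 fun t => (hF t).continuousAt
  refine ((hFc.mul (Complex.continuous_ofReal.comp hφ.contDiff_deriv.continuous)).continuousOn).sub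
    ((hφ.continuousOn_emW hF₁ hF₂c).mul ?_)
  exact (Complex.continuous_ofReal.comp (continuous_perB2.comp hφ.smooth.continuous)).continuousOn

include hφ in
/-- The symbol bound of order two in the crude form `|φ''(t)| ≤ 2 C₂` on `[H, ∞)`
(`t⁻¹ log(t+2) ≤ 2` for `t ≥ 1`). [folklore] -/
theorem ChirpPhase.abs_deriv_deriv_le {t : ℝ} (ht : H ≤ t) :
    |deriv (deriv φ) t| ≤ 2 * max (Cφ 2) 0 := by
  have h1 := hφ.symb 2 t (by norm_num) ht
  rw [iteratedDeriv_succ, iteratedDeriv_one] at h1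
  have ht1 : 1 ≤ t := hφ.one_le.trans ht
  have ht0 : 0 < t := by linarith
  have hlog : Real.log (t + 2) ≤ t + 1 := by
    linarith [Real.log_le_sub_one_of_pos (by linarith : (0 : ℝ) < t + 2)]
  have hrpow : t ^ (1 - ((2 : ℕ) : ℝ)) = t⁻¹ := by norm_num; exact Real.rpow_neg_one t
  rw [hrpow] at h1
  have h2 : t⁻¹ * Real.log (t + 2) ≤ 2 := by rw [inv_mul_le_iff₀ ht0]; linarith
  have h3 : 0 ≤ t⁻¹ * Real.log (t + 2) :=
    mul_nonneg (inv_nonneg.mpr ht0.le) (Real.log_nonneg (by linarith))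
  calc |deriv (deriv φ) t| ≤ Cφ 2 * t⁻¹ * Real.log (t + 2) := h1
    _ = Cφ 2 * (t⁻¹ * Real.log (t + 2)) := by ring
    _ ≤ max (Cφ 2) 0 * (t⁻¹ * Real.log (t + 2)) :=
        mul_le_mul_of_nonneg_right (le_max_left _ _) h3
    _ ≤ max (Cφ 2) 0 * 2 := mul_le_mul_of_nonneg_left h2 (le_max_right _ _)
    _ = 2 * max (Cφ 2) 0 := by ring

include hφ in
/-- Size of the Euler–Maclaurin weight on `[H, ∞)`:
`‖W(t)‖ ≤ ‖F₂(t)‖/L + 2C₂‖F₁(t)‖/L²`. [folklore] -/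
theorem ChirpPhase.norm_emW_le (F₁ F₂ : ℝ → ℂ) {t : ℝ} (ht : H ≤ t) :
    ‖emW φ F₁ F₂ t‖ ≤ L⁻¹ * ‖F₂ t‖ + 2 * max (Cφ 2) 0 * L⁻¹ * L⁻¹ * ‖F₁ t‖ := by
  have hL := hφ.deriv_ge t ht
  have hpos := hφ.pos.trans_le hL
  have hLi : 0 ≤ L⁻¹ := inv_nonneg.mpr hφ.pos.le
  have hv : |(deriv φ t)⁻¹| ≤ L⁻¹ := by
    rw [abs_of_pos (inv_pos.mpr hpos)]; exact inv_anti₀ hφ.pos hL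
  have hw : |deriv (deriv φ) t * (deriv φ t)⁻¹ * (deriv φ t)⁻¹| ≤
      2 * max (Cφ 2) 0 * L⁻¹ * L⁻¹ := by
    rw [abs_mul, abs_mul]
    have := hφ.abs_deriv_deriv_le ht
    exact mul_le_mul (mul_le_mul this hv (abs_nonneg _) (by positivity)) hv (abs_nonneg _)
      (by positivity)
  unfold emW
  calc ‖F₂ t * (((deriv φ t)⁻¹ : ℝ) : ℂ) -
        F₁ t * ((deriv (deriv φ) t * (deriv φ t)⁻¹ * (deriv φ t)⁻¹ : ℝ) : ℂ)‖
      ≤ ‖F₂ t * (((deriv φ t)⁻¹ : ℝ) : ℂ)‖ +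
        ‖F₁ t * ((deriv (deriv φ) t * (deriv φ t)⁻¹ * (deriv φ t)⁻¹ : ℝ) : ℂ)‖ :=
        norm_sub_le _ _
    _ = ‖F₂ t‖ * |(deriv φ t)⁻¹| +
        ‖F₁ t‖ * |deriv (deriv φ) t * (deriv φ t)⁻¹ * (deriv φ t)⁻¹| := by
        rw [norm_mul, norm_mul, Complex.norm_real, Complex.norm_real, Real.norm_eq_abs,
          Real.norm_eq_abs]
    _ ≤ ‖F₂ t‖ * L⁻¹ + ‖F₁ t‖ * (2 * max (Cφ 2) 0 * L⁻¹ * L⁻¹) := by gcongr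
    _ = L⁻¹ * ‖F₂ t‖ + 2 * max (Cφ 2) 0 * L⁻¹ * L⁻¹ * ‖F₁ t‖ := by ring

variable (hφH : φ H = 0) {γ : ℕ → ℝ} (hγ : ∀ n, H ≤ γ n ∧ φ (γ n) = n)

include hφ hφH hγ hF hF₁ hF₂c in
/-- **Second-order Euler–Maclaurin formula along the level set, finite form**:
`Σ_{n<N} F(γ_n) = ½F(H) − ½F(γ_N) + ∫_H^{γ_N} (F φ' − W P(φ))`. [folklore] -/
theorem ChirpPhase.sum_range_level_eq (N : ℕ) :
    ∑ n ∈ Finset.range N, F (γ n) = F H / 2 - F (γ N) / 2 +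
      ∫ t in H..γ N, (F t * ((deriv φ t : ℝ) : ℂ) - emW φ F₁ F₂ t * ((perB2 (φ t) : ℝ) : ℂ)) := by
  have h0 := hφ.level_zero hφH hγ
  have hsm := hφ.strictMono_level hγ
  have hint : ∀ a b, H ≤ a → a ≤ b → IntervalIntegrable (fun t => F t * ((deriv φ t : ℝ) : ℂ) -
      emW φ F₁ F₂ t * ((perB2 (φ t) : ℝ) : ℂ)) volume a b := fun a b ha hab =>
    ((hφ.continuousOn_emIntegrand hF hF₁ hF₂c).mono (Icc_subset_Ici_iff hab |>.mpr ha)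
      ).intervalIntegrable_of_Icc hab
  induction N with
  | zero => simp [h0]
  | succ N ih =>
    rw [Finset.sum_range_succ, ih]
    have hle : γ N ≤ γ (N + 1) := (hsm (Nat.lt_succ_self N)).le
    have hHN : H ≤ γ N := (hγ N).1
    have hpos : ∀ t ∈ Icc (γ N) (γ (N + 1)), 0 < deriv φ t := fun t ht =>
      hφ.pos.trans_le (hφ.deriv_ge t (hHN.trans ht.1))
    have hb : φ (γ (N + 1)) = (N : ℝ) + 1 := by rw [(hγ (N + 1)).2]; push_cast; ring
    have hcell := cell_identity hle hφ.smooth hpos (hγ N).2 hb hF hF₁ hF₂c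
    -- on the cell, `q(φ − N) = P(φ)`
    have hcongr : ∫ t in γ N..γ (N + 1), (F t * ((deriv φ t : ℝ) : ℂ) -
        (F₂ t * ((deriv φ t)⁻¹ : ℝ) -
          F₁ t * ((deriv (deriv φ) t * (deriv φ t)⁻¹ * (deriv φ t)⁻¹ : ℝ) : ℂ)) *
        ((((φ t - N) ^ 2 - (φ t - N)) / 2 : ℝ) : ℂ)) =
        ∫ t in γ N..γ (N + 1), (F t * ((deriv φ t : ℝ) : ℂ) -
          emW φ F₁ F₂ t * ((perB2 (φ t) : ℝ) : ℂ)) := by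
      refine intervalIntegral.integral_congr fun t ht => ?_
      rw [uIcc_of_le hle] at ht
      have hφt : φ t ∈ Icc (((N : ℤ) : ℝ)) ((N : ℤ) + 1) := by
        have hmono := hφ.strictMonoOn.monotoneOn
        have h1 : φ (γ N) ≤ φ t := hmono (hγ N).1 (hHN.trans ht.1 : H ≤ t) ht.1
        have h2 : φ t ≤ φ (γ (N + 1)) := hmono (hHN.trans ht.1 : H ≤ t) (hγ (N + 1)).1 ht.2
        rw [(hγ N).2] at h1
        rw [hb] at h2
        exact ⟨by exact_mod_cast h1, by exact_mod_cast h2⟩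
      simp only [emW, perB2_eq_of_mem_Icc hφt, Int.cast_natCast]
    rw [hcongr] at hcell
    have hadd := intervalIntegral.integral_add_adjacent_intervals (hint H (γ N) le_rfl hHN)
      (hint (γ N) (γ (N + 1)) hHN hle)
    rw [← hadd, ← hcell]
    ring

include hφ hφH hγ hF hF₁ hF₂c in
/-- **Second-order Euler–Maclaurin formula along the level set**: if `F φ'` and `W P(φ)` are
integrable on `(H, ∞)` and `F → 0` at `+∞`, then
`Σ_{n<N} F(γ_n) → ½F(H) + ∫_{τ>H} F φ' − ∫_{τ>H} W P(φ)`. [folklore] -/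
theorem ChirpPhase.tendsto_sum_range_level
    (hI₁ : IntegrableOn (fun t => F t * ((deriv φ t : ℝ) : ℂ)) (Ioi H))
    (hI₂ : IntegrableOn (fun t => emW φ F₁ F₂ t * ((perB2 (φ t) : ℝ) : ℂ)) (Ioi H))
    (hF0 : Tendsto F atTop (𝓝 0)) :
    Tendsto (fun N => ∑ n ∈ Finset.range N, F (γ n)) atTop
      (𝓝 (F H / 2 + ((∫ t in Ioi H, F t * ((deriv φ t : ℝ) : ℂ)) -
        ∫ t in Ioi H, emW φ F₁ F₂ t * ((perB2 (φ t) : ℝ) : ℂ)))) := by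
  have hT := hφ.tendsto_level hγ
  have h1 := intervalIntegral_tendsto_integral_Ioi H hI₁ hT
  have h2 := intervalIntegral_tendsto_integral_Ioi H hI₂ hT
  have h3 : Tendsto (fun N => F (γ N)) atTop (𝓝 0) := hF0.comp hT
  have heq : (fun N => ∑ n ∈ Finset.range N, F (γ n)) = fun N => F H / 2 - F (γ N) / 2 +
      ((∫ t in H..γ N, F t * ((deriv φ t : ℝ) : ℂ)) -
        ∫ t in H..γ N, emW φ F₁ F₂ t * ((perB2 (φ t) : ℝ) : ℂ)) := by
    funext N
    have hHN : H ≤ γ N := (hγ N).1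
    rw [hφ.sum_range_level_eq hF hF₁ hF₂c hφH hγ N, intervalIntegral.integral_sub]
    · exact (intervalIntegrable_iff_integrableOn_Ioc_of_le hHN).mpr
        (hI₁.mono_set Ioc_subset_Ioi_self)
    · exact (intervalIntegrable_iff_integrableOn_Ioc_of_le hHN).mpr
        (hI₂.mono_set Ioc_subset_Ioi_self)
  rw [heq]
  have := (tendsto_const_nhds (x := F H / 2)).sub (h3.div_const 2) |>.add (h1.sub h2)
  simpa using this

/-! ## The boundary identity `∫ ρ_H W = −∫ ρ_H' F₁/φ'` -/

include hφ hF₁ in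
/-- **`W = (F₁/φ')'` integrated against the lower cut-off**: if `ρ_H W` is integrable on
`(H, ∞)` and `F₁ → 0` at `+∞`, then `∫_{τ>H} ρ_H W = −∫_{τ>H} ρ_H' F₁/φ'` (one integration by
parts; `ρ_H = 0` near `H`, `ρ_H' ` lives on `[H + 1/4, H + 1/2]`). [folklore] -/
theorem ChirpPhase.integral_rhoCut_mul_emW
    (hWi : IntegrableOn (fun t => ((rhoCut H t : ℝ) : ℂ) * emW φ F₁ F₂ t) (Ioi H))
    (hF₁0 : Tendsto F₁ atTop (𝓝 0)) :
    ∫ t in Ioi H, ((rhoCut H t : ℝ) : ℂ) * emW φ F₁ F₂ t =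
      -∫ t in Ioi H, ((deriv (rhoCut H) t * (deriv φ t)⁻¹ : ℝ) : ℂ) * F₁ t := by
  have hF₁c : Continuous F₁ := continuous_iff_continuousAt.2 fun t => (hF₁ t).continuousAt
  have hρ := contDiff_rhoCut H
  have hρd : ∀ t, HasDerivAt (rhoCut H) (deriv (rhoCut H) t) t := fun t =>
    ((hρ.differentiable (by simp)) t).hasDerivAt
  have hρ'c : Continuous (deriv (rhoCut H)) := (contDiff_infty_iff_deriv.1 hρ).2.continuous
  have hφ'sm := hφ.contDiff_deriv
  have hφd2 : ∀ t, HasDerivAt (deriv φ) (deriv (deriv φ) t) t := fun t =>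
    ((hφ'sm.differentiable (by simp)) t).hasDerivAt
  have hne : ∀ t, H < t → deriv φ t ≠ 0 := fun t ht => (hφ.pos.trans_le (hφ.deriv_ge t ht.le)).ne'
  -- `ρ'` vanishes off `[H + 1/4, H + 1/2]`
  have hρ'z : ∀ t, (t < H + 1 / 4 ∨ H + 1 / 2 < t) → deriv (rhoCut H) t = 0 := by
    intro t ht
    rcases ht with ht | ht
    · have : rhoCut H =ᶠ[𝓝 t] fun _ => (0 : ℝ) := by
        filter_upwards [Iio_mem_nhds ht] with s hs using rhoCut_eq_zero hs.le
      rw [this.deriv_eq, deriv_const]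
    · have : rhoCut H =ᶠ[𝓝 t] fun _ => (1 : ℝ) := by
        filter_upwards [Ioi_mem_nhds ht] with s hs using rhoCut_eq_one hs.le
      rw [this.deriv_eq, deriv_const]
  set f : ℝ → ℂ := fun t => ((rhoCut H t * (deriv φ t)⁻¹ : ℝ) : ℂ) * F₁ t with hf
  set f' : ℝ → ℂ := fun t => ((deriv (rhoCut H) t * (deriv φ t)⁻¹ : ℝ) : ℂ) * F₁ t +
    ((rhoCut H t : ℝ) : ℂ) * emW φ F₁ F₂ t with hf'
  have hderiv : ∀ t ∈ Ioi H, HasDerivAt f (f' t) t := by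
    intro t ht
    have hv : HasDerivAt (fun s => (deriv φ s)⁻¹)
        (-(deriv (deriv φ) t) / (deriv φ t) ^ 2) t := (hφd2 t).inv (hne t ht)
    have h1 := (((hρd t).fun_mul hv).ofReal_comp).fun_mul (hF₁ t)
    refine h1.congr_deriv ?_
    have hne' : ((deriv φ t : ℝ) : ℂ) ≠ 0 := Complex.ofReal_ne_zero.mpr (hne t ht)
    simp only [hf', emW]
    push_cast
    field_simp
    ring
  have hfz : ∀ t, t < H + 1 / 4 → f t = 0 := fun t ht => by
    simp [hf, rhoCut_eq_zero ht.le]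
  have hcont : ContinuousWithinAt f (Ici H) H := by
    have : f =ᶠ[𝓝 H] fun _ => 0 := by
      filter_upwards [Iio_mem_nhds (show H < H + 1 / 4 by linarith)] with s hs using hfz s hs
    exact ((continuousAt_congr this).2 continuousAt_const).continuousWithinAt
  have hlim : Tendsto f atTop (𝓝 0) := by
    rw [tendsto_zero_iff_norm_tendsto_zero]
    have hb : Tendsto (fun t => L⁻¹ * ‖F₁ t‖) atTop (𝓝 0) := by
      have := (tendsto_zero_iff_norm_tendsto_zero.1 hF₁0).const_mul L⁻¹
      simpa using this
    refine squeeze_zero' (Eventually.of_forall fun t => norm_nonneg _) ?_ hb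
    filter_upwards [Ioi_mem_atTop H] with t ht
    rw [hf, norm_mul, Complex.norm_real, Real.norm_eq_abs, abs_mul]
    have h1 : |rhoCut H t| ≤ 1 := abs_rhoCut_le H t
    have h2 : |(deriv φ t)⁻¹| ≤ L⁻¹ := by
      have hL := hφ.deriv_ge t ht.le
      rw [abs_of_pos (inv_pos.mpr (hφ.pos.trans_le hL))]
      exact inv_anti₀ hφ.pos hL
    calc |rhoCut H t| * |(deriv φ t)⁻¹| * ‖F₁ t‖ ≤ 1 * L⁻¹ * ‖F₁ t‖ := by
          gcongr
      _ = L⁻¹ * ‖F₁ t‖ := by ring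
  -- integrability of `f'`
  have hI1 : IntegrableOn (fun t => ((deriv (rhoCut H) t * (deriv φ t)⁻¹ : ℝ) : ℂ) * F₁ t)
      (Ioi H) := by
    have hc : ContinuousOn (fun t => ((deriv (rhoCut H) t * (deriv φ t)⁻¹ : ℝ) : ℂ) * F₁ t)
        (Ioi H) :=
      (Complex.continuous_ofReal.comp_continuousOn (hρ'c.continuousOn.mul
        (hφ'sm.continuous.continuousOn.inv₀ fun t ht => hne t ht))).mul hF₁c.continuousOn
    have h1 : IntegrableOn (fun t => ((deriv (rhoCut H) t * (deriv φ t)⁻¹ : ℝ) : ℂ) * F₁ t)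
        (Icc (H + 1 / 4) (H + 1 / 2)) :=
      (hc.mono fun t ht => lt_of_lt_of_le (by linarith) ht.1).integrableOn_compact isCompact_Icc
    refine h1.of_forall_sdiff_eq_zero measurableSet_Ioi fun t ht => ?_
    have ht2 : ¬ (H + 1 / 4 ≤ t ∧ t ≤ H + 1 / 2) := ht.2
    have : deriv (rhoCut H) t = 0 := by
      rcases not_and_or.mp ht2 with h | h
      · exact hρ'z t (Or.inl (not_le.mp h))
      · exact hρ'z t (Or.inr (not_le.mp h))
    simp [this]
  have hI' : IntegrableOn f' (Ioi H) := hI1.add hWi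
  have hint := integral_Ioi_of_hasDerivAt_of_tendsto hcont hderiv hI' hlim
  rw [hfz H (by linarith), sub_zero, hf', integral_add hI1 hWi] at hint
  linear_combination hint

end EM

end Literature.Analysis.Fourier
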